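import Literature.Computability.Cryptography.HallgrenClassGroup
import Literature.NumberTheory.QuadraticFields.FundamentalDiscriminant
import Literature.NumberTheory.QuadraticFields.DedekindZetaReducedForms
import HarnessLib

/-!
# Hallgren 2005 / class numbers under GRH — step N1: the discriminant and class-number glue

Topic `Literature/Computability/Cryptography`; first proof companion of `HallgrenClassGroup.lean`
(named fact `Hallgren2005_classNumber_qsolvable_of_GRH`: under `GrandRiemannHypothesisGL`, the
search problem `bin(d) ↦ bin(h(−d))` on negative fundamental discriminants `−d` is `IsQSolvable`).
Everything here is PROVED (theorems only; no definition, no named fact).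

The statement of the fact is phrased with the *combinatorial* class number
`BinaryQuadraticForm.classNumber (−d)` (number of reduced primitive positive definite forms,
Cox Thm. 2.13) and the route-side predicate `IsNegFundamentalDiscr d`. Any quantum algorithm for
it computes in the *group* `Cl(𝓞_K)`, `K = ℚ(√−d)`; this file supplies the dictionary:

* `IsNegFundamentalDiscr.three_le`, `.neg_lt_zero`, `.emod_four` — elementary shape of `d`;
* `IsNegFundamentalDiscr.exists_numberField` — there is an imaginary quadratic field `K` with
  `d_K = −d` (the tree's `Quadratic.exists_numberField_discr_eq`, Marcus Ch. 2 Thm. 1);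
* `IsNegFundamentalDiscr.classNumber_eq` — for every quadratic `K` with `d_K = −d`,
  `h(−d) = h_K = |Cl(𝓞_K)|` (the tree's `Quadratic.card_reducedForms_eq_classNumber`, Cox
  Thm. 7.7(ii) with Thm. 2.13);
* `IsNegFundamentalDiscr.isPrimitive_of_discr_eq` — every form of a fundamental discriminant is
  primitive (so composition and sampling never leave the forms counted by `h`);
* `IsNegFundamentalDiscr.classNumber_pos`, `classNumber_le_sq` — `1 ≤ h(−d) ≤ d²` (output-length
  bookkeeping for the circuit family: `bin(h(−d))` has at most `2|bin(d)| + 1` bits).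

## References

* A. M. Childs, W. van Dam, *Quantum algorithms for algebraic problems*, Rev. Mod. Phys. 82 (2010),
  §5.7 (p. 24 of arXiv:0812.0380): "If `K = ℚ[√−d]` is an imaginary quadratic number field, then
  its elements have unique representatives that can be computed efficiently" [ChildsVandam2010].
* D. A. Cox, *Primes of the form x² + ny²*, 2nd ed. (2013), Thm. 2.13, §7.B Thm. 7.7(ii),
  Lemma 2.3 / Exercise 2.9 context (forms of a fundamental discriminant are primitive) [Cox2013].
-/

noncomputable section

namespace Literature.Computability.Cryptography

open Literature.NumberTheory.QuadraticFields
open Literature.NumberTheory.QuadraticFields.BinaryQuadraticForm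

namespace IsNegFundamentalDiscr

variable {d : ℕ}

/-- A negative fundamental discriminant `−d` has `d ≥ 3` (`−3`, `−4` are the first two). [folklore] -/
theorem three_le (h : IsNegFundamentalDiscr d) : 3 ≤ d := by
  rcases h with ⟨h1, -, -⟩ | ⟨h4, h2, -⟩ <;> omega

/-- `−d < 0` for a negative fundamental discriminant `−d`. [folklore] -/
theorem neg_lt_zero (h : IsNegFundamentalDiscr d) : (-(d : ℤ)) < 0 := by
  have := h.three_le
  omega

/-- `d ≠ 0` for a negative fundamental discriminant `−d`. [folklore] -/
theorem ne_zero (h : IsNegFundamentalDiscr d) : d ≠ 0 := by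
  have := h.three_le
  omega

/-- A fundamental discriminant is `≡ 0` or `1 (mod 4)`. [folklore] -/
theorem emod_four (h : IsNegFundamentalDiscr d) : (-(d : ℤ)) % 4 = 0 ∨ (-(d : ℤ)) % 4 = 1 := by
  rcases h with ⟨h1, -, -⟩ | ⟨h4, -, -⟩ <;> omega

/-- **There is an imaginary quadratic field of discriminant `−d`** (Marcus, *Number Fields*, Ch. 2,
Thm. 1: quadratic fields ↔ fundamental discriminants; the tree's
`Quadratic.exists_numberField_discr_eq`). [folklore] -/
theorem exists_numberField (h : IsNegFundamentalDiscr d) :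
    ∃ (K : Type) (_ : Field K) (_ : NumberField K),
      Module.finrank ℚ K = 2 ∧ NumberField.discr K = -(d : ℤ) :=
  Quadratic.exists_numberField_discr_eq h

/-- **`h(−d) = h_K`**: for every quadratic field `K` of discriminant `−d`, the number of reduced
primitive positive definite forms of discriminant `−d` is the class number of `K` (Cox, Thm. 7.7(ii)
with Thm. 2.13; the tree's `Quadratic.card_reducedForms_eq_classNumber`). [cite: Cox2013, §7.B Thm. 7.7(ii)] -/
theorem classNumber_eq (h : IsNegFundamentalDiscr d) {K : Type*} [Field K] [NumberField K]
    (h2 : Module.finrank ℚ K = 2) (hK : NumberField.discr K = -(d : ℤ)) :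
    classNumber (-(d : ℤ)) = NumberField.classNumber K := by
  rw [← hK]
  exact Quadratic.card_reducedForms_eq_classNumber h2 (hK ▸ h.neg_lt_zero)

/-- **`h(−d) = |Cl(𝓞_K)|`** (the same, with Mathlib's `NumberField.classNumber` unfolded to the
cardinality of the class group). [cite: Cox2013, §7.B Thm. 7.7(ii)] -/
theorem classNumber_eq_card_classGroup (h : IsNegFundamentalDiscr d) {K : Type*} [Field K]
    [NumberField K] (h2 : Module.finrank ℚ K = 2) (hK : NumberField.discr K = -(d : ℤ)) :
    classNumber (-(d : ℤ)) = Fintype.card (ClassGroup (NumberField.RingOfIntegers K)) :=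
  h.classNumber_eq h2 hK

/-- `h(−d) ≥ 1` (the principal form is reduced). [folklore] -/
theorem classNumber_pos (h : IsNegFundamentalDiscr d) : 0 < classNumber (-(d : ℤ)) :=
  BinaryQuadraticForm.classNumber_pos h.neg_lt_zero h.emod_four

/-- **Every form of a fundamental discriminant is primitive**: if `b² − 4ac = −d` with `−d`
fundamental then `gcd(a, b, c) = 1`. Indeed `g = gcd(a, b, c)` has `g² ∣ −d`, so `g² ∈ {1, 4}`
(`Quadratic.sq_eq_one_or_four_of_sq_dvd`); `g = 2` would make `−d/4 = (b/2)² − 4(a/2)(c/2)` a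
discriminant, i.e. `≡ 0, 1 (mod 4)`, against `−d/4 ≡ 2, 3 (mod 4)` (and `4 ∤ −d` in the odd case).
Cox, §2.A (Lemma 2.3 context). [folklore] -/
theorem isPrimitive_of_discr_eq (h : IsNegFundamentalDiscr d) {Q : ℤ × ℤ × ℤ}
    (hQ : discr Q = -(d : ℤ)) : IsPrimitive Q := by
  obtain ⟨a, b, c⟩ := Q
  rw [discr_apply] at hQ
  rw [isPrimitive_iff]
  obtain ⟨g, hg⟩ : ∃ g : ℕ, Int.gcd (Int.gcd a b) c = g := ⟨_, rfl⟩
  have hga : (g : ℤ) ∣ a :=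
    hg ▸ (Int.gcd_dvd_left (Int.gcd a b : ℤ) c).trans (Int.gcd_dvd_left a b)
  have hgb : (g : ℤ) ∣ b :=
    hg ▸ (Int.gcd_dvd_left (Int.gcd a b : ℤ) c).trans (Int.gcd_dvd_right a b)
  have hgc : (g : ℤ) ∣ c := hg ▸ Int.gcd_dvd_right (Int.gcd a b : ℤ) c
  obtain ⟨a', ha⟩ := hga
  obtain ⟨b', hb⟩ := hgb
  obtain ⟨c', hc⟩ := hgc
  have hsq : (g : ℤ) ^ 2 ∣ -(d : ℤ) :=
    ⟨b' ^ 2 - 4 * a' * c', by rw [← hQ, ha, hb, hc]; ring⟩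
  rw [hg]
  rcases Quadratic.sq_eq_one_or_four_of_sq_dvd h hsq with h1 | h4
  · have h1' : g ^ 2 = 1 := by exact_mod_cast h1
    exact (Nat.pow_eq_one.mp h1').resolve_right two_ne_zero
  · exfalso
    have h4' : g ^ 2 = 2 ^ 2 := by norm_num; exact_mod_cast h4
    have hg2 : g = 2 := Nat.pow_left_injective two_ne_zero h4'
    rw [ha, hb, hc, hg2] at hQ
    have hD : -(d : ℤ) = 4 * (b' ^ 2 - 4 * a' * c') := by rw [← hQ]; push_cast; ring
    rcases h with ⟨h1, -, -⟩ | ⟨-, h2, -⟩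
    · omega
    · rw [hD, Int.mul_ediv_cancel_left _ (by norm_num : (4 : ℤ) ≠ 0)] at h2
      rcases discr_emod_four (a', b', c') with h0 | h0 <;> rw [discr_apply] at h0 <;> omega

end IsNegFundamentalDiscr

/-- **`h(D) ≤ (|D|/3)(2|D|/3 + 1)`**: the reduced forms of discriminant `D` are among the triples
`(a, b, (b² − D)/4a)` with `1 ≤ a ≤ |D|/3`, `|b| ≤ |D|/3` (definition of `reducedForms`).
[folklore] -/
theorem classNumber_le_coeffBound (D : ℤ) :
    classNumber D ≤ coeffBound D * (2 * coeffBound D + 1) := by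
  unfold classNumber reducedForms
  refine Finset.card_image_le.trans ((Finset.card_filter_le _ _).trans ?_)
  rw [Finset.card_product, Int.card_Icc, Int.card_Icc]
  have h1 : ((coeffBound D : ℤ) + 1 - 1).toNat = coeffBound D := by simp
  have h2 : ((coeffBound D : ℤ) + 1 - -(coeffBound D : ℤ)).toNat = 2 * coeffBound D + 1 := by
    have : (coeffBound D : ℤ) + 1 - -(coeffBound D : ℤ) = ((2 * coeffBound D + 1 : ℕ) : ℤ) := by
      push_cast; ring
    rw [this, Int.toNat_natCast]
  rw [h1, h2]

/-- **`h(−d) ≤ d²`** — a crude polynomial bound on the class number (so `bin(h(−d))` has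
`O(|bin(d)|)` bits; the truth is `h(−d) ≪ √d log d`). [folklore] -/
theorem classNumber_le_sq (d : ℕ) : classNumber (-(d : ℤ)) ≤ d * d := by
  refine (classNumber_le_coeffBound _).trans ?_
  have hcb : coeffBound (-(d : ℤ)) = d / 3 := by simp [coeffBound]
  rw [hcb]
  have h3 : 3 * (d / 3) ≤ d := Nat.mul_div_le d 3
  have hsq : d / 3 ≤ d / 3 * (d / 3) := Nat.le_mul_self _
  nlinarith

/-- The binary length of `h(−d)` is at most `2 · |bin(d)| + 1`... in the weak form actually used:
`h(−d) < 2 ^ (2 * (Nat.size d))`. [folklore] -/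
theorem classNumber_lt_two_pow (d : ℕ) : classNumber (-(d : ℤ)) < 2 ^ (2 * Nat.size d) := by
  have h := classNumber_le_sq d
  have hd : d < 2 ^ Nat.size d := Nat.lt_size_self d
  calc classNumber (-(d : ℤ)) ≤ d * d := h
    _ < 2 ^ Nat.size d * 2 ^ Nat.size d := by
        rcases Nat.eq_zero_or_pos d with rfl | hpos
        · simp
        · exact Nat.mul_lt_mul'' hd hd
    _ = 2 ^ (2 * Nat.size d) := by rw [← pow_add, two_mul]

end Literature.Computability.Cryptography

end
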